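import Summits.Schanuel.Schanuel.Theorems.RootDecomp1KDegreeLadder06

/-!
# RootDecomp1KDegreeLadder — lens 1, generation 45 «DEGREE LADDER AT FIXED SKEL-QUALITY (DL) + THIN-FIBRE RESIDUAL» (lane K-R30 (b); CLAIM L2155, ACK/CHECKLIST K-g45 L2159, NODE L2213 / REQUEST L2214, writer re-checks L2219/L2221/L2230, critic VERDICT L2216: CLEARED — THEOREM ×1 for DL `degreeLadder`; EDITION 2/3 docstring-only accepted L2224 / files of record L2228 (K ed. 3 f2af863f…); RULE K-R31; lens-1 tally credits ×11 + THEOREM ×2) — continuation (RootDecomp1KDegreeLadder07): §7 tightness at d = 1 (degreeLadder_tight_one, ¬TF(1), ¬TF(0))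

(lens-1 g45 HOME kernel K = HOME/decomp-schanuel-lens-1/g45/DegreeLadder.lean EDITION 3 f2af863f…, 2183 l, imports tree `…RootDecomp1KSkelCell01` (the tree now has `…SkelCell10` with §8's `SkelLiouvilleFix`); P DLprobe.lean f44a49e4… rc 0, C DLctrl.lean 394594cd… rc 1 = exactly the 13 planted errors. Port by census-1 gen 19 as `RootDecomp1KDegreeLadder01`–`08` (+ `09` deferred): 01 = K's module doc + §0 residue (`skelLiouvilleFix_of_skelLiouville`, `SkelLiouvilleFix.liouville` / `.transcendental` declared in the TREE namespace `…RootDecomp1KSkelCell` so dot-notation keeps working) + §1 toolkit `bev`/`xdeg`/`dX`/`specX`; 02 = §2 truncations + §3 calculus (`tangent`, Lipschitz, `coeff_specX_bound`); 03 = §4 engine A (`onCurve_exponent_ineq`, `engine_core`); 04 = §4 engine B (`lowDegree_clause`, `engine_of_clause`, `engine`) + §5 THE DEGREE LADDER `degreeLadder (d) (ρ) (hρ : SkelLiouvilleFix (d + 1) ρ) (P : ℤ[X][X]) (hP : P ≠ 0) (hdeg : P.natDegree ≤ d) : bev P (liouvilleNumber 2) ρ ≠ 0` (descent `no_relation_of_engine`);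 05 = §5b limit corollary (`algebraicIndependent_of_forall_fix`) + §5c relative degree (`relDegree_gt`, `skelFix_two_not_mem_adjoin(_complex)`); 06 = §5d the residual `ThinFibre`/`ThinFibreAt` (+ glue `thinFibre_imp_b`) + §6 the toy fibre decided (`sq_fibre_iff`, `toy_clause`); 07 = §7 tightness at d = 1 (`degreeLadder_tight_one`, `rU_injective`, `not_thinFibre_one`, `not_thinFibre_zero`); 08 = §8a the 2-adic mechanism (`two_adic_split`, `two_adic_quality`, hypothesis-free); 09 (DEFERRED until Literature `…DiophantineApproximation.RidoutIntegers` builds on the check farm, rc 75 today) = §8b `isSquare_mul_psNumer_finite`, `isSquare_seventeen_mul_psNumer_finite`, `thinFibreAt_sqMulP` with `Ridout.padicRoth_int` BY NAME (K carries them under a `(hR : PadicRothInt)` binder whose `def` is NOT landed — verdict condition (c)).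
PORT EDITS: import `…SkelCell10` instead of `…SkelCell01` and DELETE K's verbatim copies of the tree's §8 (`SkelLiouvilleFix`, `skelLiouville_iff_fix`, `SkelLiouvilleFix.mono`, `uStar`, `dU`, `rU`, `dU_cast`, `two_pow_le_four_mul_dU`, `two_mul_dU_lt`, `one_le_dU`, `rU_den`, `rU_cast`, `uStar_sub_rU`, `skelLiouvilleFix_one_uStar`, `not_skelFixOne_algebraicIndependent` — 15 blocks, opened from `…RootDecomp1KSkelCell` by name; verdict condition (a)); the file-wide linter option dropped (b); 58 one-line docstrings added to undocumented helper lemmas; 34 small generic ℓ₂/`psNumer`/`partialSum`/cast lemmas made PRIVATE (dedup-safety against tree twins in TwoBaseCell/CommonRadixCell/SkelCell/RadixCell) with per-part private copies; `ThinFibre`/`ThinFibreAt` docstrings carry the residual-class tag (d); graded statements and proofs otherwise verbatim. `--supports stmt-Schanuel-33364`; no census credit carried; rung 0 — nothing here proves Schanuel, `FiniteOrderLiouvilleSchanuel` (33364), `CoordLiouvilleSchanuel` (31077) or (b) at fixed quality.)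
-/

noncomputable section

open Polynomial LiouvilleNumber
open scoped Nat

namespace Summit.Schanuel.Schanuel.Theorems.RootDecomp1KDegreeLadder

open Summit.Schanuel.Schanuel.Theorems.RootDecomp1KSkelCell
  (exists_le_two_pow_factorial iota iota_spec iota_le_of_le pow_lt_of_lt_iota lt_iota_of_pow_lt iota_mono
   one_le_iota SkelLiouville SkelLiouvilleFix skelLiouville_iff_fix SkelLiouvilleFix.mono uStar dU rU dU_cast
   two_pow_le_four_mul_dU two_mul_dU_lt one_le_dU rU_den rU_cast uStar_sub_rU skelLiouvilleFix_one_uStar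
   not_skelFixOne_algebraicIndependent)
open Summit.Schanuel.Schanuel.Theorems.RootDecomp1KTwoBaseCell (psNumer partialSum_eq_psNumer_div coprime_psNumer
  algebraicIndependent_of_forall_int')
open Summit.Schanuel.Schanuel.Theorems.RootDecomp1KRelLiouvilleCell (partialSum_two_strictMono
  partialSum_two_lt_liouvilleNumber abs_liouvilleNumber_two_sub_partialSum)

/-- `s_N = p_N / 2^{N!}` (tree `partialSum_eq_psNumer_div` at `b = 2`). -/
private theorem partialSum_two (N : ℕ) : partialSum 2 N = (psNumer 2 N : ℝ) / (2 : ℝ) ^ N ! := by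
  have := partialSum_eq_psNumer_div (b := 2) (by norm_num) N
  simpa using this

/-! ## §7  TIGHTNESS AT `d = 1` — the `m = 1` ceiling `u⋆ = 1/(ℓ₂ − 1)`; `ThinFibre 1` is FALSE

`degreeLadder 1` needs `ρ ∈ Skel₍₂₎`; ONE RUNG LOWER it fails: `u⋆ := 1/(ℓ₂ − 1) ∈ Skel₍₁₎` (approximants
`r_N = 1/(s_N − 1) = 2^{N!}/d_N`, `d_N = p_N − 2^{N!}` odd `< 2^{N!}/2`, so `ι(d_N) ≤ N` and
`|u⋆ − r_N| < 32·2^{−(N+1)!} ≤ d_N^{−N}`) lies ON the line `(x − 1)·y = 1` of `Y`-degree 1 through `x = ℓ₂`.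
So the exponent `m = d + 1` of DL is SHARP at `d = 1`.  Whether `m = d + 1` is sharp for `d ≥ 2` (a
`ρ ∈ Skel₍d₎` algebraic of degree exactly `d` over `ℚ(ℓ₂)`) is OPEN here.  The same line carries a rational
point `r_N` above EVERY level with `den(r_N)^N ≤ 2^{(N+1)!}`: `ThinFibre 1` is false (`not_thinFibre_one`),
matching the failure of (b) at `m₀ = 1`.  (The `u⋆` lemmas re-prove, inside this namespace, §8 of the g44
HOME kernel `SkelCell.lean` — tree port part 10 pending at the time of writing.) -/
section Tightness

/-- `s_1 = 1`. -/
private theorem partialSum_two_one' : partialSum 2 1 = 1 := by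
  simp [partialSum, Finset.sum_range_succ]; norm_num

/-- `1 < ℓ₂`. -/
private theorem one_lt_ell2 : 1 < liouvilleNumber 2 := by
  rw [← partialSum_two_one']; exact partialSum_two_lt_liouvilleNumber 1

/-- `s_2 = 5/4`. -/
private theorem partialSum_two_two' : partialSum 2 2 = 5 / 4 := by
  simp [partialSum, Finset.sum_range_succ, Nat.factorial]; norm_num

/-- `5/4 ≤ s_N` for `N ≥ 2`. -/
private theorem five_fourths_le_partialSum {N : ℕ} (hN : 2 ≤ N) : 5 / 4 ≤ partialSum 2 N := by
  rw [← partialSum_two_two']; exact partialSum_two_strictMono.monotone hN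

/-- `ℓ₂ < 41/32`. -/
private theorem ell2_lt : liouvilleNumber 2 < 41 / 32 := by
  have h := abs_liouvilleNumber_two_sub_partialSum 2
  rw [partialSum_two_two'] at h
  have h' := (abs_lt.mp h).2
  norm_num [Nat.factorial] at h'
  linarith

/-- `p_N = 2^{N!} s_N` as reals. -/
private theorem psNumer_two_cast (N : ℕ) : (psNumer 2 N : ℝ) = 2 ^ N ! * partialSum 2 N := by
  rw [partialSum_two N]; field_simp

/-- `2^{N!} < p_N` for `N ≥ 2`. -/
private theorem two_pow_lt_psNumer {N : ℕ} (hN : 2 ≤ N) : 2 ^ N ! < psNumer 2 N := by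
  have h := psNumer_two_cast N
  have hs := five_fourths_le_partialSum hN
  have hpos : (0 : ℝ) < 2 ^ N ! := by positivity
  have : ((2 ^ N ! : ℕ) : ℝ) < (psNumer 2 N : ℝ) := by rw [h]; push_cast; nlinarith
  exact_mod_cast this

/-- `d_N^N ≤ 2^{(N+1)!}` (`d_N < 2^{N!}/2`, `N!·N ≤ (N+1)!`); with room `32·d_N^N ≤ 2^{(N+1)!}` for `N ≥ 5`. -/
private theorem dU_pow_le {N : ℕ} (hN : 2 ≤ N) : ((dU N : ℝ)) ^ N * 2 ^ N ≤ 2 ^ (N + 1)! := by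
  have h2d := two_mul_dU_lt hN
  have h2dR : 2 * (dU N : ℝ) ≤ 2 ^ N ! := by exact_mod_cast h2d.le
  have h1 : (2 * (dU N : ℝ)) ^ N ≤ ((2 : ℝ) ^ N !) ^ N := pow_le_pow_left₀ (by positivity) h2dR N
  rw [mul_pow, ← pow_mul] at h1
  have hexp : (2 : ℝ) ^ (N ! * N) ≤ 2 ^ (N + 1)! :=
    pow_le_pow_right₀ (by norm_num)
      (by rw [Nat.factorial_succ, mul_comm]; exact Nat.mul_le_mul_right _ (Nat.le_succ N))
  nlinarith [h1, hexp]

/-- The line `(x − 1)·Y − 1 ∈ ℤ[x][Y]` (`Y`-degree 1) through `(ℓ₂, u⋆)`. -/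
def lineP : ℤ[X][X] := C (X - 1) * X + C (-1)

/-- `lineP(x, y) = (x − 1)·y − 1`. -/
@[simp] theorem bev_lineP (x y : ℝ) : bev lineP x y = (x - 1) * y - 1 := by
  rw [lineP, bev_add, bev_mul, bev_C, bev_X, bev_C, map_sub, aeval_X, map_one, map_neg, map_one,
    ← sub_eq_add_neg]

/-- `lineP ≠ 0`. -/
theorem lineP_ne_zero : lineP ≠ 0 := by
  intro h
  have := congrArg (fun P : ℤ[X][X] => (P.coeff 0).coeff 0) h
  simp [lineP, coeff_C, coeff_X] at this

/-- `lineP` has `Y`-degree `≤ 1`. -/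
theorem natDegree_lineP_le : lineP.natDegree ≤ 1 := natDegree_linear_le

/-- `u⋆ = 1/(ℓ₂ − 1)` lies on the line: `lineP(ℓ₂, u⋆) = 0`. -/
theorem bev_lineP_uStar : bev lineP (liouvilleNumber 2) uStar = 0 := by
  rw [bev_lineP]
  have h : liouvilleNumber 2 - 1 ≠ 0 := sub_ne_zero.mpr (ne_of_gt one_lt_ell2)
  unfold uStar
  field_simp
  ring

/-- **TIGHTNESS OF DL AT `d = 1`.**  The hypothesis `Skel₍d+1₎ = Skel₍₂₎` of `degreeLadder 1` cannot be
lowered to `Skel₍₁₎`: `u⋆ ∈ Skel₍₁₎` is a root of the nonzero `Y`-degree-1 polynomial `(x − 1)Y − 1` at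
`x = ℓ₂`.  (For `d ≥ 2` the sharpness of `m = d + 1` is OPEN.) -/
theorem degreeLadder_tight_one : ∃ ρ : ℝ, SkelLiouvilleFix 1 ρ ∧
    ∃ P : ℤ[X][X], P ≠ 0 ∧ P.natDegree ≤ 1 ∧ bev P (liouvilleNumber 2) ρ = 0 :=
  ⟨uStar, skelLiouvilleFix_one_uStar, lineP, lineP_ne_zero, natDegree_lineP_le, bev_lineP_uStar⟩

/-- `r_N ↦ 1/(s_N − 1)` is injective on `N ≥ 2` (the `s_N` increase strictly). -/
theorem rU_injective : Function.Injective fun N : ℕ => rU (N + 2) := by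
  intro a b hab
  have h : ((rU (a + 2) : ℚ) : ℝ) = ((rU (b + 2) : ℚ) : ℝ) := by
    simp only at hab; rw [hab]
  rw [rU_cast (by omega), rU_cast (by omega)] at h
  have ha := five_fourths_le_partialSum (show 2 ≤ a + 2 by omega)
  have hb := five_fourths_le_partialSum (show 2 ≤ b + 2 by omega)
  have hs : partialSum 2 (a + 2) = partialSum 2 (b + 2) := by
    have h1 : partialSum 2 (a + 2) - 1 ≠ 0 := by linarith
    have h2 : partialSum 2 (b + 2) - 1 ≠ 0 := by linarith
    field_simp at h
    linarith
  have := partialSum_two_strictMono.injective hs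
  omega

/-- **`ThinFibre 1` IS FALSE**: the line `(x − 1)·Y = 1` carries the non-degenerate rational point
`r_N = 2^{N!}/d_N ∈ [0, 4]` above EVERY level `s_N` (`N ≥ 2`) with `den(r_N)^{1·N} = d_N^N ≤ 2^{(N+1)!}/2^N`. -/
theorem not_thinFibre_one : ¬ ThinFibre 1 := by
  intro hTF
  obtain ⟨N₀, hN₀⟩ := hTF lineP lineP_ne_zero 4
  have hN2 : 2 ≤ N₀ + 2 := by omega
  have hs := five_fourths_le_partialSum hN2
  have hs1 : (0 : ℝ) < partialSum 2 (N₀ + 2) - 1 := by linarith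
  have hwin : |((rU (N₀ + 2) : ℚ) : ℝ)| ≤ 4 := by
    rw [rU_cast hN2, abs_of_pos (one_div_pos.mpr hs1), div_le_iff₀ hs1]
    linarith
  have hon : bev lineP (partialSum 2 (N₀ + 2)) (rU (N₀ + 2)) = 0 := by
    have h1 : partialSum 2 (N₀ + 2) - 1 ≠ 0 := hs1.ne'
    rw [bev_lineP, rU_cast hN2]
    field_simp
    ring
  have hnd : ∃ x : ℝ, bev lineP x (rU (N₀ + 2)) ≠ 0 := ⟨1, by rw [bev_lineP]; norm_num⟩
  have h := hN₀ (N₀ + 2) (by omega) (rU (N₀ + 2)) hwin hon hnd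
  rw [rU_den hN2, one_mul] at h
  have hle := dU_pow_le hN2
  have h2 : (1 : ℝ) ≤ 2 ^ (N₀ + 2) := one_le_pow₀ (by norm_num)
  have hdN : (0 : ℝ) ≤ (dU (N₀ + 2) : ℝ) ^ (N₀ + 2) := by positivity
  have hW : (0 : ℝ) < 2 ^ (N₀ + 2 + 1)! := by positivity
  nlinarith

/-- Hence (b) at quality `1` cannot be rescued by the thin-fibre route either (consistent with `uStar`). -/
theorem not_thinFibre_zero : ¬ ThinFibre 0 := fun h => not_thinFibre_one (h.mono (Nat.zero_le 1))

end Tightness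

end Summit.Schanuel.Schanuel.Theorems.RootDecomp1KDegreeLadder

end
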